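import Literature.Analysis.Complex.VerticalLineShift
import Literature.Analysis.Complex.VerticalLineIntegrals
import Literature.Analysis.Complex.RectangleCauchyFormula
import Mathlib.Analysis.SpecialFunctions.Pow.Complex
import HarnessLib

/-!
# The Perron-type kernel of Montgomery's explicit formula: vertical-line evaluations

Trunk T-ANT (`Literature/NumberTheory/LFunctions`), support for the discharge of the named fact
(P1) `Literature.NumberTheory.LFunctions.montgomery_explicit_formula` (`MontgomeryPairCorrelation.lean`;
Montgomery 1973, Lemma; Goldston 2005, Proposition 1 (3.11)). Proofs only (no definitions, no named
facts).

Montgomery's explicit formula is the contour-integral explicit formula for the kernel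
`r(s) = x^s (1/(s − s₁) − 1/(s − s₂))`, `s₁ = −1/2 + it`, `s₂ = 3/2 + it`, for which
`r(1/2 + iγ) = 2x^{1/2+iγ}/(1 + (γ − t)²)`. On the Dirichlet-series side one needs the Perron-type
evaluations of the pair kernel on a vertical line `re s = c` strictly between the two poles:
for `y₀ > 0`,

* `Montgomery.integral_cpow_mul_inv_sub_inv_of_one_le` :
  `∫ y₀^{c+iy} (1/(c+iy−a) − 1/(c+iy−b)) dy = 2π y₀^a` for `y₀ ≥ 1`, `re a < c < re b`
  (close to the left across the pole `a`);
* `Montgomery.integral_cpow_mul_inv_sub_inv_of_le_one` : the same integral equals `2π y₀^b` for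
  `0 < y₀ ≤ 1` (close to the right across the pole `b`); at `y₀ = 1` both values are `2π`.

With `y₀ = x/n` these give Montgomery's weights `a_n(x) = min((n/x)^{1/2}, (x/n)^{3/2})`
(`montgomeryCoeff`). The tools are the tree's vertical-line machinery
(`Literature/Analysis/Complex/VerticalLineShift.lean`, `VerticalLineIntegrals.lean`,
`RectangleCauchyFormula.lean`): here we add

* `Montgomery.integral_vertical_div_sub_eq` — shifting a vertical line across ONE simple pole:
  `i∫ g(b+yi)/(b+yi−p) dy − i∫ g(a+yi)/(a+yi−p) dy = 2πi g(p)` for `g` holomorphic on the closed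
  strip, by Cauchy's integral formula on `[a,b] × [−T,T]` and `T → ∞`;
* `Montgomery.exists_norm_inv_sub_inv_le_left/right` — the decay `‖1/(s−a) − 1/(s−b)‖ ≤ C/‖s‖²` on
  half-planes away from the poles, feeding `integral_vertical_mul_cpow_eq_zero_of_one_le/_le_one`.

## References

* H. L. Montgomery, *The pair correlation of zeros of the zeta function*, Proc. Sympos. Pure Math.
  24 (1973), 181–193, Lemma.
* D. A. Goldston, *Notes on pair correlation of zeros and prime numbers*, LMS Lecture Note Ser. 322
  (2005), Proposition 1, (3.11)–(3.14).
* H. L. Montgomery, R. C. Vaughan, *Multiplicative Number Theory I*, CUP 2007, §5.1 (Perron's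
  formula), §12.1.
-/

noncomputable section

open Complex Set MeasureTheory Filter intervalIntegral Real
open scoped Topology

namespace Literature.NumberTheory.LFunctions

namespace Montgomery

open Literature.Analysis.Complex

/-! ## Shifting a vertical line past one simple pole -/

/-- **Shifting a vertical line of integration across one simple pole.** Let `g` be complex
differentiable on the closed strip `a ≤ re s ≤ b` and `a < re p < b`; assume `g(s)/(s − p)` is
absolutely integrable along `re s = a` and `re s = b` and uniformly small on the horizontal segments
`[a,b] + iT` as `|T| → ∞`. Then `i∫ g(b+yi)/(b+yi−p) dy − i∫ g(a+yi)/(a+yi−p) dy = 2πi g(p)`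
(Cauchy's integral formula on `[a,b] × [−T,T]`, `T → ∞`). [folklore] -/
theorem integral_vertical_div_sub_eq {g : ℂ → ℂ} {a b : ℝ} {p : ℂ} (hpa : a < p.re) (hpb : p.re < b)
    (hg : DifferentiableOn ℂ g (re ⁻¹' Icc a b))
    (ha : Integrable fun y : ℝ ↦ g (a + y * I) / (a + y * I - p))
    (hb : Integrable fun y : ℝ ↦ g (b + y * I) / (b + y * I - p))
    (hdecay : ∀ ε : ℝ, 0 < ε → ∃ T₀ : ℝ, ∀ T : ℝ, T₀ ≤ |T| → ∀ x ∈ Icc a b,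
      ‖g (x + T * I) / (x + T * I - p)‖ ≤ ε) :
    I * (∫ y : ℝ, g (b + y * I) / (b + y * I - p)) -
      I * (∫ y : ℝ, g (a + y * I) / (a + y * I - p)) = 2 * π * I * g p := by
  have hab : a ≤ b := (hpa.trans hpb).le
  set F : ℂ → ℂ := fun s ↦ g s / (s - p) with hF
  -- Cauchy's formula on `[a,b] × [-T,T]` for `T > |Im p|`
  have hrect : ∀ T : ℝ, |p.im| < T →
      I * (∫ y in (-T)..T, F (b + y * I)) - I * (∫ y in (-T)..T, F (a + y * I)) =
        2 * π * I * g p - (∫ x in a..b, F (x + ((-T : ℝ) : ℂ) * I)) +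
          (∫ x in a..b, F (x + T * I)) := by
    intro T hT
    have hT1 : -T < p.im := by have := neg_abs_le p.im; linarith
    have hT2 : p.im < T := (le_abs_self _).trans_lt hT
    have h := integral_boundary_rect_div_sub_eq (f := g) p hpa hpb hT1 hT2
      (hg.mono fun z hz ↦ hz.1)
    simp only [hF]
    linear_combination h
  have hright : Tendsto (fun T : ℝ ↦ ∫ y in (-T)..T, F (b + y * I)) atTop
      (𝓝 (∫ y : ℝ, F (b + y * I))) :=
    intervalIntegral_tendsto_integral hb tendsto_neg_atTop_atBot tendsto_id
  have hleft : Tendsto (fun T : ℝ ↦ ∫ y in (-T)..T, F (a + y * I)) atTop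
      (𝓝 (∫ y : ℝ, F (a + y * I))) :=
    intervalIntegral_tendsto_integral ha tendsto_neg_atTop_atBot tendsto_id
  have hlim1 : Tendsto (fun T : ℝ ↦ I * (∫ y in (-T)..T, F (b + y * I)) -
      I * (∫ y in (-T)..T, F (a + y * I))) atTop
      (𝓝 (I * (∫ y : ℝ, F (b + y * I)) - I * (∫ y : ℝ, F (a + y * I)))) :=
    (hright.const_mul I).sub (hleft.const_mul I)
  -- the horizontal sides tend to zero
  have hlim2 : Tendsto (fun T : ℝ ↦ I * (∫ y in (-T)..T, F (b + y * I)) -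
      I * (∫ y in (-T)..T, F (a + y * I))) atTop (𝓝 (2 * π * I * g p)) := by
    rw [Metric.tendsto_atTop]
    intro ε hε
    set ε' : ℝ := ε / (2 * (b - a) + 1) with hε'
    have hba : 0 ≤ b - a := sub_nonneg.2 hab
    have hε'0 : 0 < ε' := div_pos hε (by positivity)
    obtain ⟨T₀, hT₀⟩ := hdecay ε' hε'0
    refine ⟨max (max T₀ 0) (|p.im| + 1), fun T hT ↦ ?_⟩
    have hT0 : 0 ≤ T := le_trans (le_max_right _ _) (le_of_max_le_left hT)
    have hTp : |p.im| < T := by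
      have := le_of_max_le_right hT; linarith
    have hTabs : T₀ ≤ |T| := by
      rw [abs_of_nonneg hT0]; exact le_trans (le_max_left _ _) (le_of_max_le_left hT)
    have hTabs' : T₀ ≤ |(-T)| := by rwa [abs_neg]
    rw [hrect T hTp, dist_eq_norm]
    have htop : ‖∫ x in a..b, F (x + T * I)‖ ≤ ε' * |b - a| :=
      norm_integral_le_of_norm_le_const fun x hx ↦
        hT₀ T hTabs x (by rw [uIoc_of_le hab] at hx; exact ⟨hx.1.le, hx.2⟩)
    have hbot : ‖∫ x in a..b, F (x + ((-T : ℝ) : ℂ) * I)‖ ≤ ε' * |b - a| :=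
      norm_integral_le_of_norm_le_const fun x hx ↦
        hT₀ (-T) hTabs' x (by rw [uIoc_of_le hab] at hx; exact ⟨hx.1.le, hx.2⟩)
    rw [abs_of_nonneg hba] at htop hbot
    calc ‖2 * π * I * g p - (∫ x in a..b, F (x + ((-T : ℝ) : ℂ) * I)) +
          (∫ x in a..b, F (x + T * I)) - 2 * π * I * g p‖
        = ‖(∫ x in a..b, F (x + T * I)) - ∫ x in a..b, F (x + ((-T : ℝ) : ℂ) * I)‖ := by
          congr 1; ring
      _ ≤ ε' * (b - a) + ε' * (b - a) := (norm_sub_le _ _).trans (add_le_add htop hbot)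
      _ < ε := by
          have : ε' * (2 * (b - a) + 1) = ε := by rw [hε']; field_simp
          nlinarith
  exact tendsto_nhds_unique hlim1 hlim2

/-! ## The pair kernel `1/(s−a) − 1/(s−b)`: decay -/

/-- `|s − a| ≥ δ‖s‖/(‖a‖ + δ)` whenever `|s − a| ≥ δ > 0`. [folklore] -/
theorem norm_sub_ge_of_norm_sub_ge {s a : ℂ} {δ : ℝ} (hδ : 0 < δ) (h : δ ≤ ‖s - a‖) :
    δ * ‖s‖ / (‖a‖ + δ) ≤ ‖s - a‖ := by
  rw [div_le_iff₀ (by positivity)]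
  rcases le_or_gt ‖s‖ (‖a‖ + δ) with hs | hs
  · calc δ * ‖s‖ ≤ δ * (‖a‖ + δ) := mul_le_mul_of_nonneg_left hs hδ.le
      _ ≤ ‖s - a‖ * (‖a‖ + δ) := mul_le_mul_of_nonneg_right h (by positivity)
  · have h1 : ‖s‖ - ‖a‖ ≤ ‖s - a‖ := norm_sub_norm_le s a
    nlinarith [norm_nonneg a]

/-- **Decay of the pair kernel on a left half-plane**: for `c < re a`, `c < re b`, `c < 0` there is
`C` with `‖1/(s−a) − 1/(s−b)‖ ≤ C/‖s‖²` for `re s ≤ c`. [folklore] -/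
theorem exists_norm_inv_sub_inv_le_left (a b : ℂ) {c : ℝ} (hca : c < a.re) (hcb : c < b.re)
    (hc : c < 0) :
    ∃ C : ℝ, ∀ s : ℂ, s.re ≤ c → ‖1 / (s - a) - 1 / (s - b)‖ ≤ C / ‖s‖ ^ 2 := by
  set δa := a.re - c with hδa
  set δb := b.re - c with hδb
  have hδa0 : 0 < δa := by rw [hδa]; linarith
  have hδb0 : 0 < δb := by rw [hδb]; linarith
  refine ⟨‖a - b‖ * ((‖a‖ + δa) / δa) * ((‖b‖ + δb) / δb), fun s hs ↦ ?_⟩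
  have hsa : δa ≤ ‖s - a‖ := by
    have := abs_re_le_norm (s - a)
    rw [sub_re] at this
    have h2 : δa ≤ |s.re - a.re| := by rw [abs_sub_comm, abs_of_pos (by linarith)]; linarith
    linarith
  have hsb : δb ≤ ‖s - b‖ := by
    have := abs_re_le_norm (s - b)
    rw [sub_re] at this
    have h2 : δb ≤ |s.re - b.re| := by rw [abs_sub_comm, abs_of_pos (by linarith)]; linarith
    linarith
  have hs0 : 0 < ‖s‖ := by
    have := abs_re_le_norm s
    have : 0 < |s.re| := by rw [abs_of_neg (by linarith)]; linarith
    linarith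
  have hsa' := norm_sub_ge_of_norm_sub_ge hδa0 hsa
  have hsb' := norm_sub_ge_of_norm_sub_ge hδb0 hsb
  have hne_a : s - a ≠ 0 := fun h ↦ by rw [h, norm_zero] at hsa; linarith
  have hne_b : s - b ≠ 0 := fun h ↦ by rw [h, norm_zero] at hsb; linarith
  have e : 1 / (s - a) - 1 / (s - b) = (a - b) / ((s - a) * (s - b)) := by
    field_simp; ring
  rw [e, norm_div, norm_mul, div_le_div_iff₀ (by positivity) (by positivity)]
  -- `‖a-b‖ ‖s‖² ≤ C ‖s-a‖ ‖s-b‖`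
  have h1 : δa * ‖s‖ / (‖a‖ + δa) * (δb * ‖s‖ / (‖b‖ + δb)) ≤ ‖s - a‖ * ‖s - b‖ :=
    mul_le_mul hsa' hsb' (by positivity) (norm_nonneg _)
  have e2 : ‖a - b‖ * ((‖a‖ + δa) / δa) * ((‖b‖ + δb) / δb) *
      (δa * ‖s‖ / (‖a‖ + δa) * (δb * ‖s‖ / (‖b‖ + δb))) = ‖a - b‖ * ‖s‖ ^ 2 := by
    field_simp
  calc ‖a - b‖ * ‖s‖ ^ 2 = ‖a - b‖ * ((‖a‖ + δa) / δa) * ((‖b‖ + δb) / δb) *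
      (δa * ‖s‖ / (‖a‖ + δa) * (δb * ‖s‖ / (‖b‖ + δb))) := e2.symm
    _ ≤ ‖a - b‖ * ((‖a‖ + δa) / δa) * ((‖b‖ + δb) / δb) * (‖s - a‖ * ‖s - b‖) :=
        mul_le_mul_of_nonneg_left h1 (by positivity)

/-- **Decay of the pair kernel on a right half-plane**: for `re a < c`, `re b < c`, `0 < c` there is
`C` with `‖1/(s−a) − 1/(s−b)‖ ≤ C/‖s‖²` for `c ≤ re s`. [folklore] -/
theorem exists_norm_inv_sub_inv_le_right (a b : ℂ) {c : ℝ} (hca : a.re < c) (hcb : b.re < c)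
    (hc : 0 < c) :
    ∃ C : ℝ, ∀ s : ℂ, c ≤ s.re → ‖1 / (s - a) - 1 / (s - b)‖ ≤ C / ‖s‖ ^ 2 := by
  obtain ⟨C, hC⟩ := exists_norm_inv_sub_inv_le_left (-a) (-b) (c := -c)
    (by simp only [neg_re]; linarith) (by simp only [neg_re]; linarith) (by linarith)
  refine ⟨C, fun s hs ↦ ?_⟩
  have h := hC (-s) (by simp only [neg_re]; linarith)
  rw [norm_neg] at h
  refine le_trans (le_of_eq ?_) h
  rw [← norm_neg]
  congr 1
  have e1 : -s - -a = -(s - a) := by ring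
  have e2 : -s - -b = -(s - b) := by ring
  rw [e1, e2]
  simp only [one_div, inv_neg]
  ring


/-! ## Vertical-line evaluations of `∫ y₀^s (1/(s−a) − 1/(s−b)) ds` -/

/-- The pair kernel is complex differentiable away from `a` and `b`. [folklore] -/
theorem differentiableOn_inv_sub_inv (a b : ℂ) {U : Set ℂ} (hU : ∀ s ∈ U, s ≠ a ∧ s ≠ b) :
    DifferentiableOn ℂ (fun s : ℂ ↦ 1 / (s - a) - 1 / (s - b)) U := by
  refine DifferentiableOn.sub ?_ ?_
  · exact (differentiableOn_const 1).div (differentiableOn_id.sub_const a)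
      fun s hs ↦ sub_ne_zero.2 (hU s hs).1
  · exact (differentiableOn_const 1).div (differentiableOn_id.sub_const b)
      fun s hs ↦ sub_ne_zero.2 (hU s hs).2

/-- On a vertical line `re s = c` with `c ≠ re d`, `c + yi − d ≠ 0`. [folklore] -/
theorem ofReal_add_mul_I_sub_ne_zero {c : ℝ} {d : ℂ} (hd : d.re ≠ c) (y : ℝ) :
    (c : ℂ) + y * I - d ≠ 0 := by
  intro h0
  have := congrArg Complex.re h0
  simp at this
  exact hd (by linarith)

/-- `‖y₀^{c+iy}‖ = y₀^c` for `y₀ > 0`. [folklore] -/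
theorem norm_cpow_vertical {y₀ : ℝ} (hy : 0 < y₀) (c y : ℝ) :
    ‖(y₀ : ℂ) ^ ((c : ℂ) + y * I)‖ = y₀ ^ c := by
  rw [norm_cpow_eq_rpow_re_of_pos hy]; simp

/-- Integrability of `y ↦ y₀^{c+iy}(1/(c+iy−a) − 1/(c+iy−b))` on `ℝ` (`re a, re b ≠ c`). [folklore] -/
theorem integrable_cpow_mul_inv_sub_inv {y₀ : ℝ} (hy : 0 < y₀) {c : ℝ} {a b : ℂ} (ha : a.re ≠ c)
    (hb : b.re ≠ c) :
    Integrable fun y : ℝ ↦ (y₀ : ℂ) ^ ((c : ℂ) + y * I) *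
      (1 / ((c : ℂ) + y * I - a) - 1 / ((c : ℂ) + y * I - b)) := by
  refine (VLI.integrable_inv_sub_inv ha hb).bdd_mul (c := y₀ ^ c) ?_ (ae_of_all _ fun y ↦ ?_)
  · exact (Continuous.const_cpow (by fun_prop) (Or.inl (ofReal_ne_zero.2 hy.ne'))).aestronglyMeasurable
  · rw [norm_cpow_vertical hy]

/-- The decay hypothesis of the pole-shifting lemma for `g(s)/(s − p) = y₀^s (1/(s−a) − 1/(s−b))`:
on a strip `[c₁, c₂] + iT` the kernel is `≤ y₀^{max} ‖a−b‖/((|T|−|Im a|)(|T|−|Im b|))`. [folklore] -/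
theorem decay_cpow_mul_inv_sub_inv {y₀ : ℝ} (hy : 0 < y₀) (c₁ c₂ : ℝ) (a b : ℂ) {M : ℝ}
    (hM : ∀ x ∈ Icc c₁ c₂, y₀ ^ x ≤ M) :
    ∀ ε : ℝ, 0 < ε → ∃ T₀ : ℝ, ∀ T : ℝ, T₀ ≤ |T| → ∀ x ∈ Icc c₁ c₂,
      ‖(y₀ : ℂ) ^ ((x : ℂ) + T * I) * (1 / ((x : ℂ) + T * I - a) - 1 / ((x : ℂ) + T * I - b))‖ ≤ ε := by
  intro ε hε
  refine ⟨|a.im| + |b.im| + 1 + M * ‖a - b‖ / ε, fun T hT x hx ↦ ?_⟩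
  rcases le_or_gt c₁ c₂ with h12 | h12
  swap
  · exact absurd (hx.1.trans hx.2) (not_le.2 h12)
  have hM0' : 0 ≤ M := le_trans (by positivity) (hM c₁ ⟨le_rfl, h12⟩)
  set s : ℂ := (x : ℂ) + T * I with hs
  have hsa : |T| - |a.im| ≤ ‖s - a‖ := by
    have h1 := abs_im_le_norm (s - a)
    have h2 : (s - a).im = T - a.im := by simp [hs]
    rw [h2] at h1
    have := abs_sub_abs_le_abs_sub T a.im
    linarith
  have hsb : |T| - |b.im| ≤ ‖s - b‖ := by
    have h1 := abs_im_le_norm (s - b)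
    have h2 : (s - b).im = T - b.im := by simp [hs]
    rw [h2] at h1
    have := abs_sub_abs_le_abs_sub T b.im
    linarith
  set m : ℝ := |T| - (|a.im| + |b.im|) with hm
  have hm1 : 1 + M * ‖a - b‖ / ε ≤ m := by rw [hm]; linarith
  have hmpos : 0 < m := by
    have : 0 ≤ M * ‖a - b‖ / ε := by positivity
    linarith
  have hsa' : m ≤ ‖s - a‖ := by linarith [abs_nonneg b.im]
  have hsb' : m ≤ ‖s - b‖ := by linarith [abs_nonneg a.im]
  have hne_a : s - a ≠ 0 := fun h ↦ by rw [h, norm_zero] at hsa'; linarith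
  have hne_b : s - b ≠ 0 := fun h ↦ by rw [h, norm_zero] at hsb'; linarith
  have e : (1 : ℂ) / (s - a) - 1 / (s - b) = (a - b) / ((s - a) * (s - b)) := by
    field_simp; ring
  rw [e, norm_mul, norm_cpow_vertical hy, norm_div, norm_mul]
  have hyx : y₀ ^ x ≤ M := hM x hx
  have hprod : m * m ≤ ‖s - a‖ * ‖s - b‖ := mul_le_mul hsa' hsb' hmpos.le (norm_nonneg _)
  calc y₀ ^ x * (‖a - b‖ / (‖s - a‖ * ‖s - b‖)) ≤ M * (‖a - b‖ / (m * m)) := by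
        gcongr
    _ ≤ M * (‖a - b‖ / m) := by
        refine mul_le_mul_of_nonneg_left (div_le_div_of_nonneg_left (norm_nonneg _) hmpos ?_) hM0'
        have hnn : 0 ≤ M * ‖a - b‖ / ε := by positivity
        nlinarith
    _ = M * ‖a - b‖ / m := by ring
    _ ≤ ε := by
        rw [div_le_iff₀ hmpos]
        have : M * ‖a - b‖ / ε * ε = M * ‖a - b‖ := by field_simp
        nlinarith [mul_le_mul_of_nonneg_right hm1 hε.le]

/-- **Closing to the left** (`y₀ ≥ 1`): for `re a < c < re b`,
`∫ y₀^{c+iy} (1/(c+iy−a) − 1/(c+iy−b)) dy = 2π y₀^a` — the line is moved to the left across the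
simple pole at `a` (residue `y₀^a`) and then to `−∞`, where the integral vanishes since `y₀ ≥ 1`
and the kernel is `O(|s|⁻²)` (Perron's formula for the pair kernel; Montgomery–Vaughan §5.1).
[folklore] -/
theorem integral_cpow_mul_inv_sub_inv_of_one_le {y₀ : ℝ} (hy : 1 ≤ y₀) {c : ℝ} {a b : ℂ}
    (hac : a.re < c) (hcb : c < b.re) :
    ∫ y : ℝ, (y₀ : ℂ) ^ ((c : ℂ) + y * I) *
        (1 / ((c : ℂ) + y * I - a) - 1 / ((c : ℂ) + y * I - b)) = 2 * π * (y₀ : ℂ) ^ a := by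
  have hy0 : 0 < y₀ := one_pos.trans_le hy
  have hy0' : (y₀ : ℂ) ≠ 0 := ofReal_ne_zero.2 hy0.ne'
  set c' : ℝ := min a.re 0 - 1 with hc'
  have hc'a : c' < a.re := by have := min_le_left a.re 0; linarith
  have hc'0 : c' < 0 := by have := min_le_right a.re 0; linarith
  have hc'c : c' < c := by linarith
  have hc'b : c' < b.re := by linarith
  set q : ℂ → ℂ := fun s ↦ 1 / (s - a) - 1 / (s - b) with hq
  set g : ℂ → ℂ := fun s ↦ (y₀ : ℂ) ^ s * ((a - b) / (s - b)) with hg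
  have hqg : ∀ s : ℂ, s ≠ a → s ≠ b → g s / (s - a) = (y₀ : ℂ) ^ s * q s := by
    intro s hsa hsb
    have h1 : s - a ≠ 0 := sub_ne_zero.2 hsa
    have h2 : s - b ≠ 0 := sub_ne_zero.2 hsb
    rw [hg, hq]
    field_simp
    ring
  have hline : ∀ d : ℝ, d ≠ a.re → d ≠ b.re → (fun y : ℝ ↦ g (d + y * I) / (d + y * I - a)) =
      fun y : ℝ ↦ (y₀ : ℂ) ^ ((d : ℂ) + y * I) * q (d + y * I) := by
    intro d hda hdb
    funext y
    exact hqg _ (fun h ↦ hda (by rw [← h]; simp)) (fun h ↦ hdb (by rw [← h]; simp))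
  -- Step 1: the integral over `re s = c'` vanishes
  obtain ⟨C, hC⟩ := exists_norm_inv_sub_inv_le_left a b hc'a hc'b hc'0
  have hleft0 : ∫ y : ℝ, (y₀ : ℂ) ^ ((c' : ℂ) + y * I) * q (c' + y * I) = 0 := by
    have h := integral_vertical_mul_cpow_eq_zero_of_one_le hc'0
      (differentiableOn_inv_sub_inv a b fun s (hs : s.re ≤ c') ↦
        ⟨fun h ↦ by rw [h] at hs; linarith, fun h ↦ by rw [h] at hs; linarith⟩) hC hy
    rw [← h]
    exact integral_congr_ae (ae_of_all _ fun y ↦ mul_comm _ _)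
  -- Step 2: shift from `c` to `c'` across the pole at `a`
  have hgdiff : DifferentiableOn ℂ g (re ⁻¹' Icc c' c) := by
    refine DifferentiableOn.mul (differentiableOn_id.const_cpow (Or.inl hy0')) ?_
    refine (differentiableOn_const _).div (differentiableOn_id.sub_const b) fun s hs ↦ ?_
    exact sub_ne_zero.2 fun h ↦ by rw [h] at hs; exact absurd hs.2 (not_le.2 hcb)
  have hM : ∀ x ∈ Icc c' c, y₀ ^ x ≤ y₀ ^ c := fun x hx ↦
    Real.rpow_le_rpow_of_exponent_le hy hx.2
  have hshift := integral_vertical_div_sub_eq (g := g) hc'a hac hgdiff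
    (by rw [hline c' hc'a.ne hc'b.ne]; exact integrable_cpow_mul_inv_sub_inv hy0 hc'a.ne' hc'b.ne')
    (by rw [hline c hac.ne' hcb.ne]; exact integrable_cpow_mul_inv_sub_inv hy0 hac.ne hcb.ne')
    (by
      intro ε hε
      obtain ⟨T₀, hT₀⟩ := decay_cpow_mul_inv_sub_inv hy0 c' c a b hM ε hε
      refine ⟨max T₀ (|a.im| + |b.im| + 1), fun T hT x hx ↦ ?_⟩
      have hT' : T₀ ≤ |T| := le_trans (le_max_left _ _) hT
      have hTim : |a.im| + |b.im| + 1 ≤ |T| := le_trans (le_max_right _ _) hT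
      have hxa : (x : ℂ) + T * I ≠ a := by
        intro h
        have := congrArg Complex.im h
        simp at this
        have := le_abs_self a.im
        have := neg_abs_le T
        have := le_abs_self T
        have := neg_abs_le a.im
        rcases abs_cases T with ⟨h1, _⟩ | ⟨h1, _⟩ <;> linarith [abs_nonneg b.im]
      have hxb : (x : ℂ) + T * I ≠ b := by
        intro h
        have := congrArg Complex.im h
        simp at this
        have := le_abs_self b.im
        have := neg_abs_le b.im
        rcases abs_cases T with ⟨h1, _⟩ | ⟨h1, _⟩ <;> linarith [abs_nonneg a.im]
      rw [hqg _ hxa hxb]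
      exact hT₀ T hT' x hx)
  rw [hline c' hc'a.ne hc'b.ne, hline c hac.ne' hcb.ne, hleft0, mul_zero, sub_zero] at hshift
  have hga : g a = (y₀ : ℂ) ^ a := by
    rw [hg]; dsimp only
    have : a - b ≠ 0 := sub_ne_zero.2 fun h ↦ by rw [h] at hac; linarith
    field_simp
  rw [hga] at hshift
  have hI : I ≠ 0 := I_ne_zero
  have := mul_left_cancel₀ hI (hshift.trans (by ring : 2 * ↑π * I * (y₀ : ℂ) ^ a = I * (2 * π * (y₀ : ℂ) ^ a)))
  exact this

/-- **Closing to the right** (`0 < y₀ ≤ 1`): for `re a < c < re b`,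
`∫ y₀^{c+iy} (1/(c+iy−a) − 1/(c+iy−b)) dy = 2π y₀^b` — the line is moved to the right across the
simple pole at `b` (residue `−y₀^b` of the kernel, crossed with negative orientation) and then to
`+∞`. [folklore] -/
theorem integral_cpow_mul_inv_sub_inv_of_le_one {y₀ : ℝ} (hy0 : 0 < y₀) (hy : y₀ ≤ 1) {c : ℝ}
    {a b : ℂ} (hac : a.re < c) (hcb : c < b.re) :
    ∫ y : ℝ, (y₀ : ℂ) ^ ((c : ℂ) + y * I) *
        (1 / ((c : ℂ) + y * I - a) - 1 / ((c : ℂ) + y * I - b)) = 2 * π * (y₀ : ℂ) ^ b := by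
  have hy0' : (y₀ : ℂ) ≠ 0 := ofReal_ne_zero.2 hy0.ne'
  set c' : ℝ := max b.re 0 + 1 with hc'
  have hc'b : b.re < c' := by have := le_max_left b.re 0; linarith
  have hc'0 : 0 < c' := by have := le_max_right b.re 0; linarith
  have hc'c : c < c' := by linarith
  have hc'a : a.re < c' := by linarith
  set q : ℂ → ℂ := fun s ↦ 1 / (s - a) - 1 / (s - b) with hq
  set g : ℂ → ℂ := fun s ↦ (y₀ : ℂ) ^ s * ((a - b) / (s - a)) with hg
  have hqg : ∀ s : ℂ, s ≠ a → s ≠ b → g s / (s - b) = (y₀ : ℂ) ^ s * q s := by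
    intro s hsa hsb
    have h1 : s - a ≠ 0 := sub_ne_zero.2 hsa
    have h2 : s - b ≠ 0 := sub_ne_zero.2 hsb
    rw [hg, hq]
    field_simp
    ring
  have hline : ∀ d : ℝ, d ≠ a.re → d ≠ b.re → (fun y : ℝ ↦ g (d + y * I) / (d + y * I - b)) =
      fun y : ℝ ↦ (y₀ : ℂ) ^ ((d : ℂ) + y * I) * q (d + y * I) := by
    intro d hda hdb
    funext y
    exact hqg _ (fun h ↦ hda (by rw [← h]; simp)) (fun h ↦ hdb (by rw [← h]; simp))
  -- Step 1: the integral over `re s = c'` vanishes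
  obtain ⟨C, hC⟩ := exists_norm_inv_sub_inv_le_right a b hc'a hc'b hc'0
  have hright0 : ∫ y : ℝ, (y₀ : ℂ) ^ ((c' : ℂ) + y * I) * q (c' + y * I) = 0 := by
    have h := integral_vertical_mul_cpow_eq_zero_of_le_one hc'0
      (differentiableOn_inv_sub_inv a b fun s (hs : c' ≤ s.re) ↦
        ⟨fun h ↦ by rw [h] at hs; linarith, fun h ↦ by rw [h] at hs; linarith⟩) hC hy0 hy
    rw [← h]
    exact integral_congr_ae (ae_of_all _ fun y ↦ mul_comm _ _)
  -- Step 2: shift from `c` to `c'` across the pole at `b`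
  have hgdiff : DifferentiableOn ℂ g (re ⁻¹' Icc c c') := by
    refine DifferentiableOn.mul (differentiableOn_id.const_cpow (Or.inl hy0')) ?_
    refine (differentiableOn_const _).div (differentiableOn_id.sub_const a) fun s hs ↦ ?_
    exact sub_ne_zero.2 fun h ↦ by rw [h] at hs; exact absurd hs.1 (not_le.2 hac)
  have hM : ∀ x ∈ Icc c c', y₀ ^ x ≤ y₀ ^ c := fun x hx ↦
    Real.rpow_le_rpow_of_exponent_ge hy0 hy hx.1
  have hshift := integral_vertical_div_sub_eq (g := g) hcb hc'b hgdiff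
    (by rw [hline c hac.ne' hcb.ne]; exact integrable_cpow_mul_inv_sub_inv hy0 hac.ne hcb.ne')
    (by rw [hline c' hc'a.ne' hc'b.ne']; exact integrable_cpow_mul_inv_sub_inv hy0 hc'a.ne hc'b.ne)
    (by
      intro ε hε
      obtain ⟨T₀, hT₀⟩ := decay_cpow_mul_inv_sub_inv hy0 c c' a b hM ε hε
      refine ⟨max T₀ (|a.im| + |b.im| + 1), fun T hT x hx ↦ ?_⟩
      have hT' : T₀ ≤ |T| := le_trans (le_max_left _ _) hT
      have hTim : |a.im| + |b.im| + 1 ≤ |T| := le_trans (le_max_right _ _) hT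
      have hxa : (x : ℂ) + T * I ≠ a := by
        intro h
        have := congrArg Complex.im h
        simp at this
        have := le_abs_self a.im
        have := neg_abs_le a.im
        rcases abs_cases T with ⟨h1, _⟩ | ⟨h1, _⟩ <;> linarith [abs_nonneg b.im]
      have hxb : (x : ℂ) + T * I ≠ b := by
        intro h
        have := congrArg Complex.im h
        simp at this
        have := le_abs_self b.im
        have := neg_abs_le b.im
        rcases abs_cases T with ⟨h1, _⟩ | ⟨h1, _⟩ <;> linarith [abs_nonneg a.im]
      rw [hqg _ hxa hxb]
      exact hT₀ T hT' x hx)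
  rw [hline c hac.ne' hcb.ne, hline c' hc'a.ne' hc'b.ne', hright0, mul_zero, zero_sub] at hshift
  have hgb : g b = -(y₀ : ℂ) ^ b := by
    rw [hg]; dsimp only
    have : b - a ≠ 0 := sub_ne_zero.2 fun h ↦ by rw [h] at hcb; linarith
    field_simp
    ring
  rw [hgb] at hshift
  have hI : I ≠ 0 := I_ne_zero
  have h2 : I * ∫ y : ℝ, (y₀ : ℂ) ^ ((c : ℂ) + y * I) * q (c + y * I) = I * (2 * π * (y₀ : ℂ) ^ b) := by
    linear_combination -hshift
  exact mul_left_cancel₀ hI h2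

end Montgomery

end Literature.NumberTheory.LFunctions

end
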